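/-
Copyright (c) 2026 the pub-hodgecm-mathlib formalisation cell (harness21).  Prover seat hodgecm-mathlib-K2E3-p21 (g8), Track B «K2-LIT» ∕ h413,
line `K2_E3_EllipticInputs`, unit U12 «Characters», PART «RANK», leaf (qs2-ps) `sig_K2E3CharLocIntNearPrincipalSeriesQuasiSplitTwo`, road «van Dijk₂».
SUB-BRICK (VDW-CORE₂) of (ASM₂): van Dijk's weight `Δ₂` on the WHOLE diagonal torus `T₂` of `U(Φ₂)(L⁺_v)` — closed form, realness, positivity ⇔ regularity,
continuity, `W`-symmetry (FILE A1; the junction `dg₂ = Re Δ₂` with Harish-Chandra's denominator is FILE A2 `K2E3QuasiSplitTwoWeylDiscrJunction`).  2026-09-04.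
-/
import Summits.HodgeConjecture.HodgeConjecture.Theorems.K2E3QuasiSplitTwoTorusDefs                  -- ★ p860691 (K2E3-p26 g0) D115 (TOR₂-Defs): `vanDijkWeight₂`, `dgFormula₂`, `torusChart₂`, `hyperbolicSet₂`, `glDiagonal_torusEntry_two`
import Summits.HodgeConjecture.HodgeConjecture.Theorems.F0P3cStCharTSVanDijkCore                     -- ★ (F0P3a-p07) one-place bookkeeping `isUnit_iff_apply_ne_zero`, `normAbs_apply_sub_one_eq_zero`, `normAbs_apply_sub_one_ne_zero_iff`; brings ★ ShellWeight `unitModulusChar_eq_normAbs`, `normAbs_apply_ne_zero`, `normAbs_conjLocal_apply`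
import Summits.HodgeConjecture.HodgeConjecture.Theorems.F0P3cStCharTSWeylHypMeasure                  -- ★ (LH2-p02) `isRegularElt_glDiagonal_of_isUnit_sub`, `isUnit_sub_of_isRegularElt_glDiagonal` (any `N`, any commutative ring)
import Literature.NumberTheory.Automorphic.UnitaryGroupTorusOrbitalDescentNonsplitTwo                 -- ★ (F0P3b-p01) `twistModule_cmLocal_two_eq` (`χ⁻(b − 1)⁻¹ = (√‖b − 1‖)⁻¹` on `U(1,1)`)
import Literature.NumberTheory.Automorphic.CMBorelWeylTorusConjugateTwo                               -- ★ `weylConj_mem_cmTorus_two`, `glDiagonal_rev_eq_weylConj_two`, `torusEntry_zero_weylConj_two`; brings ★ `UnitaryGroupLineBorelModulus.rootDeltaChar_cmBorel_torus_two`, `LineRing.distribHaarChar_torus_two`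
import Literature.NumberTheory.Automorphic.CMTorusRegularAEPairwise                                   -- ★ `ae_isUnit_torusEntry_sub_two`, `isUnit_sub_of_isUnit_inv_mul_sub_one`
import Literature.NumberTheory.Automorphic.LocalFieldHaarBalls                                        -- ★ `LocalFieldHaar.continuous_normAbs`
import HarnessLib

/-!
# K2_E3 road (h413 = stmt-HodgeConjecture-24833), PART «RANK», leaf (qs2-ps) «van Dijk₂» — SUB-BRICK (VDW-CORE₂):
# FILE A1: VAN DIJK'S WEIGHT `Δ₂` ON THE DIAGONAL TORUS OF `U(Φ₂)(L⁺_v) = U(1,1)(L⁺_v)` — CLOSED FORM, REALNESS, REGULARITY, CONTINUITY, `W`-SYMMETRY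
# [Rogawski1990, §12.7 L. 12.7.2 (proof) p. 193; §4.9 (4.9.4) p. 56, p. 54; §12.2 p. 173; §12.5 p. 182]

Cell `pub/hodgecm-mathlib` (D-0151), Track B (21-frontier RULING «PUSH BOTH» 2026-09-03), `--supports stmt-HodgeConjecture-24833 --as helper` (count-neutral);
THEOREMS ONLY — no `def`, no instance, no notation, no named fact, no `sorry`; ★-only imports.  Seat K2E3-p21 (g8), (ASM₂)+head of (qs2-ps) BY BOOK (dealer
K2E3-plan (g4) 2026-09-04T13:33:49Z); this file is the N = 2 twin of ★ «VDW-CORE» `F0P3cStCharTSVanDijkCore` + ★ `F0P3cStCharTSVanDijkWeylSymm.vanDijkWeight_weylConj`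
+ ★ `PsmTransport.torusChart_reflect` — the weight bookkeeping that the assembly (ASM₂) of `Theorems/K2E3CharLocIntNearPrincipalSeriesQuasiSplitTwo.lean` consumes and
that no brick D115–D119 was dealt; FILE A2 `K2E3QuasiSplitTwoWeylDiscrJunction` adds the junction `dg₂ = Re Δ₂` on `T₂` (twin of ★ `K2E3PrincipalSeriesCharPrelims` §1).

SETTING.  `v` a finite place of `L⁺`, `R = LocalRing L v = ∏_{w∣v} L_w`, `σ = conjLocal L c v`; `G₂ = U(Φ₂)(L⁺_v) = ↥(unitaryGroupOfForm σ (cmLocalForm L 2 v))`,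
`T₂ = (cmBorelTriple L 2 v).M = {d(d₀, d₁) : σ(d₀) d₁ = 1}` its diagonal torus, `dᵢ = torusEntry … i t`, `b = d₀⁻¹ d₁` (the regularity token of ★ `vanDijkWeight₂`:
`t` is regular iff `b − 1` is a unit), `‖·‖ = unitModulusChar R = ∏_w |·|_w` (★ `unitModulusChar_localRing_eq_prod`).
* §1 **`Δ₂(t) = √(‖d₀‖ · ‖b − 1‖)` on the regular set** (★ `rootDeltaChar_cmBorel_torus_two`: `δ_{B₂}^{1∕2}(t) = √‖d₀‖`; ★ `twistModule_cmLocal_two_eq`: `χ⁻(b − 1) = √‖b − 1‖`),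
  the closed forms `Δ₂(t) = √(∏_w |d₀,w|_w · ∏_w |(b − 1)_w|_w) = √(∏_w |(d₀ − d₁)_w|_w)` valid for EVERY `t` (off the regular set both sides vanish); hence `Im Δ₂ = 0`,
  `0 ≤ Re Δ₂`, `Re Δ₂(t) > 0 ⇔ b − 1` is a unit, and `Δ₂` is CONTINUOUS (measurable) on `T₂`.
* §2 regularity on `T₂`: `IsRegularElt t ⇔ b − 1` is a unit; a.e. regularity (and `Re Δ₂ > 0` a.e.) for every Haar measure on `T₂` (★ `ae_isUnit_torusEntry_sub_two`).
* §3 `W`-symmetry: `Δ₂(ʷt) = Δ₂(t)` for `ʷt = w₀ t w₀⁻¹` (`w₀` the antidiagonal Weyl element); the chart reflection `ι₂(σ(α)⁻¹) = ʷ(ι₂ α)`; `ʷ(ʷt) = t`.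
Print: `Δ(m) = |D_G(m)|` (p. 193), `D_G(γ) = |Π_{α}(1 − α(γ))|^{1∕2}` (p. 54), `= |(1 − b)(1 − b⁻¹)|_{L⁺_v}^{1∕2}` at rank one.  Every statement of §1–§3 holds at EVERY
finite `v` (no non-split hypothesis): off the regular set a component of `b − 1` vanishes and so does `∏_w |(b − 1)_w|_w`.

HONEST LABEL: HC_CM is proved only modulo the 7 printed citations (2 remaining named inputs: hLiu418 = stmt-HodgeConjecture-24832, h413 = stmt-HodgeConjecture-24833)
until rung 0 closes; count-neutral helper toward the OPEN leaf (qs2-ps); it closes nothing by itself.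

## References
* [Rogawski1990] J. D. Rogawski, *Automorphic Representations of Unitary Groups in Three Variables*, Ann. of Math. Stud. 123 (1990): §4.9 (4.9.4) p. 56, p. 54 (`D_G`);
  §12.2 p. 173; §12.5 p. 182; §12.7 L. 12.7.2 (proof) p. 193.
* [vanDijk1972] G. van Dijk, *Computation of certain induced characters of 𝔭-adic groups*, Math. Ann. 199 (1972), Thm. p. 237.
* [HarishChandra1970] Harish-Chandra (notes by G. van Dijk), *Harmonic Analysis on Reductive p-adic Groups*, LNM 162 (1970), Part VII §1 (`D_G`, Thm. 15).
* [WeilBNT1967] A. Weil, *Basic Number Theory* (1967), Ch. I §2 (the module of a local field).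
-/

set_option autoImplicit false
-- the mandated namespace has the single-problem summit's repeated segment (`HodgeConjecture.HodgeConjecture`)
set_option linter.dupNamespace false

noncomputable section

open NumberField IsDedekindDomain MeasureTheory Topology Filter
open scoped Matrix MatrixGroups NNReal
open Literature.NumberTheory.Rogawski1990 Literature.NumberTheory.Automorphic Literature.NumberTheory.Automorphic.UnitaryGroup
open Literature.NumberTheory.GaloisRepresentations Literature.NumberTheory.GaloisRepresentations.IsNonarchimedeanLocalField
open Literature.MeasureTheory.Group
open Summit.HodgeConjecture.HodgeConjecture.Cruxes.H413.K2E3QuasiSplitTwoTorusDefs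

namespace Summit.HodgeConjecture.HodgeConjecture.Cruxes.H413.K2E3QuasiSplitTwoVanDijkCore

variable (L : Type) [Field L] [NumberField L] [IsCMField L] (v : HeightOneSpectrum (𝓞 ↥(maximalRealSubfield L)))

/-! ## §1 The closed form of `Δ₂` on the regular set and on all of `T₂`; realness; positivity ⇔ regularity; continuity -/

/-- **`Δ₂(t) = √(‖d₀‖ · ‖b − 1‖)` AT A REGULAR `t ∈ T₂`** (`b = d₀⁻¹d₁`, `b − 1` a unit): ★ `vanDijkWeight₂`'s `dite` opened, its two factors read by
★ `rootDeltaChar_cmBorel_torus_two` (`δ_{B₂}^{1∕2}(t) = √‖d₀‖`) and ★ `twistModule_cmLocal_two_eq` (`χ⁻(b − 1)⁻¹ = (√‖b − 1‖)⁻¹`).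
[cite: Rogawski1990, §12.7 L. 12.7.2 (proof) p. 193; §4.9 (4.9.4) p. 56; §12.2 p. 173] [cite: vanDijk1972, Thm. p. 237] -/
theorem vanDijkWeight₂_eq_of_isUnit (t : ↥(cmBorelTriple L 2 v).M)
    (h : IsUnit ((((torusEntry (conjLocal L (IsCMField.complexConj L) v) (cmLocalForm L 2 v) 0 t)⁻¹ *
      torusEntry (conjLocal L (IsCMField.complexConj L) v) (cmLocalForm L 2 v) 1 t : (LocalRing L v)ˣ) : LocalRing L v) - 1)) :
    vanDijkWeight₂ L v t =
      (((NNReal.sqrt (unitModulusChar (LocalRing L v) (torusEntry (conjLocal L (IsCMField.complexConj L) v) (cmLocalForm L 2 v) 0 t) *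
        unitModulusChar (LocalRing L v) h.unit) : ℝ≥0) : ℝ) : ℂ) := by
  classical
  haveI := locallyCompactSpace_cmBorelU L 2 v
  rw [vanDijkWeight₂, dif_pos h]
  -- the two factors, read through ★ lemmas elaborated in their home files (no re-elaboration of the instance-laden tokens here)
  have h1 := UnitaryGroup.rootDeltaChar_cmBorel_torus_two L v t
  have h2 := UnitaryGroup.twistModule_cmLocal_two_eq L v (t := (t : ↥(unitaryGroupOfForm (conjLocal L (IsCMField.complexConj L) v) (cmLocalForm L 2 v))))
    t.2 (d := fun i => torusEntry (conjLocal L (IsCMField.complexConj L) v) (cmLocalForm L 2 v) i t) (glDiagonal_torusEntry_two L v t) h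
  have key : ∀ (a : ℂˣ) (s x y : ℝ≥0), (a : ℂ) = ((NNReal.sqrt x : ℝ≥0) : ℝ) → (s⁻¹ : ℝ≥0) = (NNReal.sqrt y)⁻¹ →
      (a : ℂ) * ((((s⁻¹ : ℝ≥0)) : ℝ) : ℂ)⁻¹ = (((NNReal.sqrt (x * y) : ℝ≥0) : ℝ) : ℂ) := by
    intro a s x y ha hs
    rw [ha, hs, NNReal.coe_inv, Complex.ofReal_inv, inv_inv, ← Complex.ofReal_mul, ← NNReal.coe_mul, ← NNReal.sqrt_mul]
  exact key _ _ _ _ ((congrArg Units.val h1).trans (coe_halfModulusChar_apply _ _)) h2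

omit [IsCMField L] in
/-- A non-unit of `R = ∏_{w∣v} L_w` has a vanishing component (units of a finite product of fields are the tuples of non-zero elements). [cite: WeilBNT1967, Ch. I §2] -/
theorem exists_apply_eq_zero_of_not_isUnit {x : LocalRing L v} (hx : ¬ IsUnit x) : ∃ w : PlacesOver L v, x w = 0 := by
  by_contra h
  push Not at h
  exact hx (isUnit_iff_exists_inv.2 ⟨fun w => (x w)⁻¹, funext fun w => mul_inv_cancel₀ (h w)⟩)

omit [IsCMField L] in
/-- … hence `∏_w |x_w|_w = 0` for a non-unit `x`. [cite: WeilBNT1967, Ch. I §2] -/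
theorem prod_normAbs_apply_eq_zero_of_not_isUnit {x : LocalRing L v} (hx : ¬ IsUnit x) :
    ∏ w : PlacesOver L v, normAbs (w.1.adicCompletion L) (x w) = 0 := by
  obtain ⟨w, hw⟩ := exists_apply_eq_zero_of_not_isUnit L v hx
  exact Finset.prod_eq_zero (Finset.mem_univ w) (by rw [hw, map_zero])

omit [IsCMField L] in
/-- `∏_w |u_w|_w ≠ 0` for a unit `u` (★ `normAbs_apply_ne_zero` componentwise). [cite: WeilBNT1967, Ch. I §2] -/
theorem prod_normAbs_apply_ne_zero (u : (LocalRing L v)ˣ) :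
    ∏ w : PlacesOver L v, normAbs (w.1.adicCompletion L) ((u : LocalRing L v) w) ≠ 0 :=
  Finset.prod_ne_zero_iff.2 fun w _ => F0P3cStCharTSShellWeight.normAbs_apply_ne_zero L v w u

omit [IsCMField L] in
/-- `∏_w |x_w|_w ≠ 0` iff `x` is a unit. [cite: WeilBNT1967, Ch. I §2] -/
theorem prod_normAbs_apply_ne_zero_iff (x : LocalRing L v) :
    ∏ w : PlacesOver L v, normAbs (w.1.adicCompletion L) (x w) ≠ 0 ↔ IsUnit x := by
  refine ⟨fun h => ?_, fun h => ?_⟩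
  · by_contra hx
    exact h (prod_normAbs_apply_eq_zero_of_not_isUnit L v hx)
  · have := prod_normAbs_apply_ne_zero L v h.unit
    rwa [h.unit_spec] at this

set_option maxHeartbeats 400000 in
/-- **`Δ₂(t) = √( ∏_w |d₀,w|_w · ∏_w |(b − 1)_w|_w )` FOR EVERY `t ∈ T₂`** (`b = d₀⁻¹d₁`; every finite `v`): `vanDijkWeight₂_eq_of_isUnit` + ★ `unitModulusChar_localRing_eq_prod`
on the regular set, ★ `vanDijkWeight₂_of_not_isUnit` off it (then a component of `b − 1` vanishes and so does the right side).
[cite: Rogawski1990, §12.7 L. 12.7.2 (proof) p. 193; §4.9 (4.9.4) p. 56] [cite: vanDijk1972, Thm. p. 237] -/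
theorem vanDijkWeight₂_eq_prod_normAbs (t : ↥(cmBorelTriple L 2 v).M) :
    vanDijkWeight₂ L v t =
      (((NNReal.sqrt ((∏ w : PlacesOver L v, normAbs (w.1.adicCompletion L) ((torusEntry (conjLocal L (IsCMField.complexConj L) v) (cmLocalForm L 2 v) 0 t : LocalRing L v) w)) *
        (∏ w : PlacesOver L v, normAbs (w.1.adicCompletion L)
          (((((torusEntry (conjLocal L (IsCMField.complexConj L) v) (cmLocalForm L 2 v) 0 t)⁻¹ *
            torusEntry (conjLocal L (IsCMField.complexConj L) v) (cmLocalForm L 2 v) 1 t : (LocalRing L v)ˣ) : LocalRing L v) - 1) w))) : ℝ≥0) : ℝ) : ℂ) := by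
  by_cases h : IsUnit ((((torusEntry (conjLocal L (IsCMField.complexConj L) v) (cmLocalForm L 2 v) 0 t)⁻¹ *
      torusEntry (conjLocal L (IsCMField.complexConj L) v) (cmLocalForm L 2 v) 1 t : (LocalRing L v)ˣ) : LocalRing L v) - 1)
  · -- explicit arguments throughout: a metavariable in the `‖·‖`-pattern makes the unifier compare `d₀` with `h.unit` by computation (timeout)
    have e1 := unitModulusChar_localRing_eq_prod L v (torusEntry (conjLocal L (IsCMField.complexConj L) v) (cmLocalForm L 2 v) 0 t)
    have e2 := unitModulusChar_localRing_eq_prod L v h.unit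
    rw [h.unit_spec] at e2
    rw [vanDijkWeight₂_eq_of_isUnit L v t h, e1, e2]
  · rw [vanDijkWeight₂_of_not_isUnit L v t h, prod_normAbs_apply_eq_zero_of_not_isUnit L v h, mul_zero, NNReal.sqrt_zero, NNReal.coe_zero,
      Complex.ofReal_zero]

/-- **`Δ₂(t)` IS REAL**: `Im Δ₂(t) = 0`. [cite: Rogawski1990, §12.7 L. 12.7.2 (proof) p. 193] -/
theorem vanDijkWeight₂_im (t : ↥(cmBorelTriple L 2 v).M) : (vanDijkWeight₂ L v t).im = 0 := by
  rw [vanDijkWeight₂_eq_prod_normAbs L v t, Complex.ofReal_im]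

/-- `((Re Δ₂(t) : ℝ) : ℂ) = Δ₂(t)` — the density-side cast `((Δ₂(ι m)).re : ℂ)` IS `Δ₂(ι m)`. [cite: Rogawski1990, §12.7 L. 12.7.2 (proof) p. 193] -/
theorem ofReal_vanDijkWeight₂_re (t : ↥(cmBorelTriple L 2 v).M) : (((vanDijkWeight₂ L v t).re : ℝ) : ℂ) = vanDijkWeight₂ L v t :=
  Complex.ext (by rw [Complex.ofReal_re]) (by rw [Complex.ofReal_im, vanDijkWeight₂_im L v t])

/-- **`Re Δ₂(t)` in `|·|_w`-tokens**: `Re Δ₂(t) = √( ∏_w |d₀,w|_w · ∏_w |(b − 1)_w|_w )`. [cite: Rogawski1990, §12.7 L. 12.7.2 (proof) p. 193; §4.9 (4.9.4) p. 56] -/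
theorem vanDijkWeight₂_re_eq_prod_normAbs (t : ↥(cmBorelTriple L 2 v).M) :
    (vanDijkWeight₂ L v t).re =
      ((NNReal.sqrt ((∏ w : PlacesOver L v, normAbs (w.1.adicCompletion L) ((torusEntry (conjLocal L (IsCMField.complexConj L) v) (cmLocalForm L 2 v) 0 t : LocalRing L v) w)) *
        (∏ w : PlacesOver L v, normAbs (w.1.adicCompletion L)
          (((((torusEntry (conjLocal L (IsCMField.complexConj L) v) (cmLocalForm L 2 v) 0 t)⁻¹ *
            torusEntry (conjLocal L (IsCMField.complexConj L) v) (cmLocalForm L 2 v) 1 t : (LocalRing L v)ˣ) : LocalRing L v) - 1) w))) : ℝ≥0) : ℝ) := by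
  rw [vanDijkWeight₂_eq_prod_normAbs L v t, Complex.ofReal_re]

/-- **`0 ≤ Re Δ₂(t)`**. [cite: Rogawski1990, §12.7 L. 12.7.2 (proof) p. 193] -/
theorem vanDijkWeight₂_re_nonneg (t : ↥(cmBorelTriple L 2 v).M) : 0 ≤ (vanDijkWeight₂ L v t).re := by
  rw [vanDijkWeight₂_re_eq_prod_normAbs L v t]
  exact NNReal.coe_nonneg _

/-- **`Re Δ₂(t) > 0` IFF `t` IS REGULAR** in the sense of ★ `vanDijkWeight₂` (`b − 1 = d₀⁻¹d₁ − 1` a unit): `∏_w |d₀,w|_w ≠ 0`, and `∏_w |(b − 1)_w|_w ≠ 0 ⟺ b − 1` is a unit.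
So `Δ₂` vanishes EXACTLY on the non-regular part of `T₂`. [cite: Rogawski1990, §12.7 L. 12.7.2 (proof) p. 193; §12.5 p. 182] -/
theorem vanDijkWeight₂_re_pos_iff (t : ↥(cmBorelTriple L 2 v).M) :
    0 < (vanDijkWeight₂ L v t).re ↔
      IsUnit ((((torusEntry (conjLocal L (IsCMField.complexConj L) v) (cmLocalForm L 2 v) 0 t)⁻¹ *
        torusEntry (conjLocal L (IsCMField.complexConj L) v) (cmLocalForm L 2 v) 1 t : (LocalRing L v)ˣ) : LocalRing L v) - 1) := by
  rw [vanDijkWeight₂_re_eq_prod_normAbs L v t, NNReal.coe_pos, pos_iff_ne_zero, ne_eq, NNReal.sqrt_eq_zero, ← ne_eq, mul_ne_zero_iff,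
    prod_normAbs_apply_ne_zero_iff L v ((((torusEntry (conjLocal L (IsCMField.complexConj L) v) (cmLocalForm L 2 v) 0 t)⁻¹ *
      torusEntry (conjLocal L (IsCMField.complexConj L) v) (cmLocalForm L 2 v) 1 t : (LocalRing L v)ˣ) : LocalRing L v) - 1)]
  exact ⟨fun h => h.2, fun h => ⟨prod_normAbs_apply_ne_zero L v _, h⟩⟩

/-- **`Δ₂` IS CONTINUOUS ON `T₂`** (closed form ∘ continuous coordinates ★ `continuous_torusEntry`, ★ `continuous_normAbs`; every finite `v`).
[cite: Rogawski1990, §12.7 L. 12.7.2 (proof) p. 193; §4.9 (4.9.4) p. 56] -/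
theorem continuous_vanDijkWeight₂ : Continuous (vanDijkWeight₂ L v) := by
  have hfun : vanDijkWeight₂ L v = fun t =>
      (((NNReal.sqrt ((∏ w : PlacesOver L v, normAbs (w.1.adicCompletion L) ((torusEntry (conjLocal L (IsCMField.complexConj L) v) (cmLocalForm L 2 v) 0 t : LocalRing L v) w)) *
        (∏ w : PlacesOver L v, normAbs (w.1.adicCompletion L)
          (((((torusEntry (conjLocal L (IsCMField.complexConj L) v) (cmLocalForm L 2 v) 0 t)⁻¹ *
            torusEntry (conjLocal L (IsCMField.complexConj L) v) (cmLocalForm L 2 v) 1 t : (LocalRing L v)ˣ) : LocalRing L v) - 1) w))) : ℝ≥0) : ℝ) : ℂ) :=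
    funext fun t => vanDijkWeight₂_eq_prod_normAbs L v t
  rw [hfun]
  have hE : ∀ w : PlacesOver L v, Continuous fun t : ↥(cmBorelTriple L 2 v).M =>
      ((torusEntry (conjLocal L (IsCMField.complexConj L) v) (cmLocalForm L 2 v) 0 t : (LocalRing L v)ˣ) : LocalRing L v) w := fun w =>
    (continuous_apply w).comp (Units.continuous_val.comp (continuous_torusEntry (conjLocal L (IsCMField.complexConj L) v) (cmLocalForm L 2 v) 0))
  have hQ : ∀ w : PlacesOver L v, Continuous fun t : ↥(cmBorelTriple L 2 v).M =>
      (((((torusEntry (conjLocal L (IsCMField.complexConj L) v) (cmLocalForm L 2 v) 0 t)⁻¹ *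
        torusEntry (conjLocal L (IsCMField.complexConj L) v) (cmLocalForm L 2 v) 1 t : (LocalRing L v)ˣ) : LocalRing L v) - 1) w) := fun w =>
    (continuous_apply w).comp ((Units.continuous_val.comp (((continuous_torusEntry (conjLocal L (IsCMField.complexConj L) v) (cmLocalForm L 2 v) 0).inv).mul
      (continuous_torusEntry (conjLocal L (IsCMField.complexConj L) v) (cmLocalForm L 2 v) 1))).sub continuous_const)
  have hN : ∀ w : PlacesOver L v, Continuous (normAbs (w.1.adicCompletion L)) := fun w => LocalFieldHaar.continuous_normAbs
  exact Complex.continuous_ofReal.comp (NNReal.continuous_coe.comp (NNReal.continuous_sqrt.comp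
    ((continuous_finsetProd _ fun w _ => (hN w).comp (hE w)).mul (continuous_finsetProd _ fun w _ => (hN w).comp (hQ w)))))

/-- `Δ₂` is (Borel) measurable on `T₂`. [cite: Rogawski1990, §12.7 L. 12.7.2 (proof) p. 193] -/
theorem measurable_vanDijkWeight₂ [MeasurableSpace ↥(cmBorelTriple L 2 v).M] [BorelSpace ↥(cmBorelTriple L 2 v).M] : Measurable (vanDijkWeight₂ L v) :=
  (continuous_vanDijkWeight₂ L v).measurable

omit [IsCMField L] in
/-- `∏_w |x_w| · ∏_w |(x⁻¹y − 1)_w| = ∏_w |(x − y)_w|` for units `x, y` of `R` (`x (x⁻¹y − 1) = y − x` and `|−z| = |z|`). [cite: WeilBNT1967, Ch. I §2] -/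
theorem prod_normAbs_mul_prod_normAbs_ratio_sub_one (x y : (LocalRing L v)ˣ) :
    (∏ w : PlacesOver L v, normAbs (w.1.adicCompletion L) ((x : LocalRing L v) w)) *
        (∏ w : PlacesOver L v, normAbs (w.1.adicCompletion L) ((((x⁻¹ * y : (LocalRing L v)ˣ) : LocalRing L v) - 1) w)) =
      ∏ w : PlacesOver L v, normAbs (w.1.adicCompletion L) (((x : LocalRing L v) - y) w) := by
  rw [← Finset.prod_mul_distrib]
  refine Finset.prod_congr rfl fun w _ => ?_
  have hyx : (x : LocalRing L v) * ((((x⁻¹ * y : (LocalRing L v)ˣ) : LocalRing L v)) - 1) = -((x : LocalRing L v) - y) := by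
    rw [Units.val_mul, mul_sub, mul_one, ← mul_assoc, Units.mul_inv, one_mul, neg_sub]
  rw [← map_mul, ← Pi.mul_apply, hyx, Pi.neg_apply, normAbs_neg]

/-- **`Δ₂(t) = √( ∏_w |(d₀ − d₁)_w|_w )` FOR EVERY `t ∈ T₂`** — the symmetric closed form (`|D_G(t)| = |d₀ − d₁|_{L_w}` at rank one, through `|d₀ d₁|_w = 1`).
[cite: Rogawski1990, §12.7 L. 12.7.2 (proof) p. 193; §4.9 p. 54] [cite: vanDijk1972, Thm. p. 237] -/
theorem vanDijkWeight₂_eq_sqrt_prod_normAbs_sub (t : ↥(cmBorelTriple L 2 v).M) :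
    vanDijkWeight₂ L v t =
      (((NNReal.sqrt (∏ w : PlacesOver L v, normAbs (w.1.adicCompletion L)
        ((((torusEntry (conjLocal L (IsCMField.complexConj L) v) (cmLocalForm L 2 v) 0 t : (LocalRing L v)ˣ) : LocalRing L v) -
          (torusEntry (conjLocal L (IsCMField.complexConj L) v) (cmLocalForm L 2 v) 1 t : (LocalRing L v)ˣ)) w)) : ℝ≥0) : ℝ) : ℂ) := by
  rw [vanDijkWeight₂_eq_prod_normAbs L v t, prod_normAbs_mul_prod_normAbs_ratio_sub_one L v]

/-- `Re Δ₂(t) = √( ∏_w |(d₀ − d₁)_w|_w )`. [cite: Rogawski1990, §12.7 L. 12.7.2 (proof) p. 193; §4.9 p. 54] -/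
theorem vanDijkWeight₂_re_eq_sqrt_prod_normAbs_sub (t : ↥(cmBorelTriple L 2 v).M) :
    (vanDijkWeight₂ L v t).re =
      ((NNReal.sqrt (∏ w : PlacesOver L v, normAbs (w.1.adicCompletion L)
        ((((torusEntry (conjLocal L (IsCMField.complexConj L) v) (cmLocalForm L 2 v) 0 t : (LocalRing L v)ˣ) : LocalRing L v) -
          (torusEntry (conjLocal L (IsCMField.complexConj L) v) (cmLocalForm L 2 v) 1 t : (LocalRing L v)ˣ)) w)) : ℝ≥0) : ℝ) := by
  rw [vanDijkWeight₂_eq_sqrt_prod_normAbs_sub L v t, Complex.ofReal_re]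

/-! ## §2 Regularity on `T₂`: `t` regular ⇔ `d₀⁻¹d₁ − 1` a unit; almost every `t` is regular -/

/-- **`t ∈ T₂` IS REGULAR (separable characteristic polynomial) IFF `b − 1 = d₀⁻¹d₁ − 1` IS A UNIT** — every finite `v`: ⇐ by ★ `isRegularElt_glDiagonal_of_isUnit_sub`
(the two differences `d₀ − d₁`, `d₁ − d₀` are units, ★ `isUnit_sub_of_isUnit_inv_mul_sub_one`), ⇒ by ★ (A0′) `isUnit_sub_of_isRegularElt_glDiagonal` and
`b − 1 = d₀⁻¹ (d₁ − d₀)`.  So the regular set of ★ `hyperbolicSet₂` and the regular branch of ★ `vanDijkWeight₂` coincide. [cite: Rogawski1990, §3.1 p. 19; §12.5 p. 182] -/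
theorem isRegularElt_coe_iff_isUnit (t : ↥(cmBorelTriple L 2 v).M) :
    IsRegularElt (((t : ↥(unitaryGroupOfForm (conjLocal L (IsCMField.complexConj L) v) (cmLocalForm L 2 v))) : GL (Fin 2) (LocalRing L v))) ↔
      IsUnit ((((torusEntry (conjLocal L (IsCMField.complexConj L) v) (cmLocalForm L 2 v) 0 t)⁻¹ *
        torusEntry (conjLocal L (IsCMField.complexConj L) v) (cmLocalForm L 2 v) 1 t : (LocalRing L v)ˣ) : LocalRing L v) - 1) := by
  have hd := glDiagonal_torusEntry_two L v t
  rw [← hd]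
  constructor
  · intro h
    have h10 := F0P3cStCharTSWeylHypFibre.isUnit_sub_of_isRegularElt_glDiagonal h (i := 1) (j := 0) (by decide)
    have he : ((((torusEntry (conjLocal L (IsCMField.complexConj L) v) (cmLocalForm L 2 v) 0 t)⁻¹ *
        torusEntry (conjLocal L (IsCMField.complexConj L) v) (cmLocalForm L 2 v) 1 t : (LocalRing L v)ˣ) : LocalRing L v) - 1) =
        (((torusEntry (conjLocal L (IsCMField.complexConj L) v) (cmLocalForm L 2 v) 0 t)⁻¹ : (LocalRing L v)ˣ) : LocalRing L v) *
          (((torusEntry (conjLocal L (IsCMField.complexConj L) v) (cmLocalForm L 2 v) 1 t : (LocalRing L v)ˣ) : LocalRing L v) -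
            (torusEntry (conjLocal L (IsCMField.complexConj L) v) (cmLocalForm L 2 v) 0 t : (LocalRing L v)ˣ)) := by
      rw [Units.val_mul, mul_sub, Units.inv_mul]
    rw [he]
    exact (Units.isUnit _).mul h10
  · intro h
    obtain ⟨h01, h10⟩ := isUnit_sub_of_isUnit_inv_mul_sub_one _ _ h
    refine F0P3cStCharTSWeylHypMeasure.isRegularElt_glDiagonal_of_isUnit_sub fun i j hij => ?_
    fin_cases i <;> fin_cases j
    · exact absurd rfl hij
    · exact h01
    · exact h10
    · exact absurd rfl hij

/-- **`Re Δ₂(t) > 0` IFF `t` IS REGULAR.** [cite: Rogawski1990, §12.7 L. 12.7.2 (proof) p. 193; §12.5 p. 182] -/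
theorem vanDijkWeight₂_re_pos_iff_isRegularElt (t : ↥(cmBorelTriple L 2 v).M) :
    0 < (vanDijkWeight₂ L v t).re ↔
      IsRegularElt (((t : ↥(unitaryGroupOfForm (conjLocal L (IsCMField.complexConj L) v) (cmLocalForm L 2 v))) : GL (Fin 2) (LocalRing L v))) := by
  rw [vanDijkWeight₂_re_pos_iff L v t, isRegularElt_coe_iff_isUnit L v t]

/-- **ALMOST EVERY `t ∈ T₂` IS REGULAR** for every Haar measure `μ_T` on `T₂` (★ `ae_isUnit_torusEntry_sub_two` + §2), and there `Re Δ₂(t) > 0`.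
[cite: Rogawski1990, §4.9 p. 55; §12.5 p. 183] [cite: HarishChandra1970, §3] -/
theorem ae_isRegularElt_and_vanDijkWeight₂_re_pos
    [MeasurableSpace ↥(unitaryGroupOfForm (conjLocal L (IsCMField.complexConj L) v) (cmLocalForm L 2 v))]
    [BorelSpace ↥(unitaryGroupOfForm (conjLocal L (IsCMField.complexConj L) v) (cmLocalForm L 2 v))]
    (μT : Measure ↥(cmBorelTriple L 2 v).M) [μT.IsHaarMeasure] :
    ∀ᵐ t : ↥(cmBorelTriple L 2 v).M ∂μT, IsRegularElt (((t : ↥(unitaryGroupOfForm (conjLocal L (IsCMField.complexConj L) v) (cmLocalForm L 2 v))) : GL (Fin 2) (LocalRing L v))) ∧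
      0 < (vanDijkWeight₂ L v t).re := by
  filter_upwards [ae_isUnit_torusEntry_sub_two L v μT] with t ht
  exact ⟨(isRegularElt_coe_iff_isUnit L v t).2 ht.2.2, (vanDijkWeight₂_re_pos_iff L v t).2 ht.2.2⟩

/-! ## §3 `W`-symmetry: `Δ₂(ʷt) = Δ₂(t)`; the chart reflection `ι₂(σ(α)⁻¹) = ʷ(ι₂ α)` -/

section Weyl

variable (w₀ : ↥(unitaryGroupOfForm (conjLocal L (IsCMField.complexConj L) v) (cmLocalForm L 2 v)))
  (hw₀ : Units.val (w₀ : GL (Fin 2) (LocalRing L v)) = cmLocalForm L 2 v)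

include hw₀ in
/-- The diagonal of `ʷt` is the reversed diagonal of `t`: `(ʷt)ᵢ = d_{rev i}` (★ `glDiagonal_rev_eq_weylConj_two`). [cite: Rogawski1990, §1.10 p. 9; §12.2 p. 173] -/
theorem torusEntry_weylConj (t : ↥(cmBorelTriple L 2 v).M) (i : Fin 2) :
    torusEntry (conjLocal L (IsCMField.complexConj L) v) (cmLocalForm L 2 v) i
        (⟨w₀ * (t : ↥(unitaryGroupOfForm (conjLocal L (IsCMField.complexConj L) v) (cmLocalForm L 2 v))) * w₀⁻¹, UnitaryGroup.weylConj_mem_cmTorus_two L v w₀ hw₀ t⟩ :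
          ↥(cmBorelTriple L 2 v).M) =
      torusEntry (conjLocal L (IsCMField.complexConj L) v) (cmLocalForm L 2 v) i.rev t := by
  have hd := glDiagonal_torusEntry_two L v t
  exact torusEntry_eq_of_glDiagonal_eq _ _ i _ _
    (UnitaryGroup.glDiagonal_rev_eq_weylConj_two (conjLocal L (IsCMField.complexConj L) v) (cmLocalForm_eq_over L 2 v) w₀ hw₀ t hd)

include hw₀ in
/-- **`Δ₂(ʷt) = Δ₂(t)`** — van Dijk's weight is `W`-invariant (`|d₁ − d₀| = |d₀ − d₁|` in the symmetric closed form of §1). [cite: Rogawski1990, §12.7 L. 12.7.2 (proof) p. 193; §12.5 p. 182] -/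
theorem vanDijkWeight₂_weylConj (t : ↥(cmBorelTriple L 2 v).M) :
    vanDijkWeight₂ L v (⟨w₀ * (t : ↥(unitaryGroupOfForm (conjLocal L (IsCMField.complexConj L) v) (cmLocalForm L 2 v))) * w₀⁻¹,
        UnitaryGroup.weylConj_mem_cmTorus_two L v w₀ hw₀ t⟩ : ↥(cmBorelTriple L 2 v).M) = vanDijkWeight₂ L v t := by
  -- rewrite the reversed entries inside the closed form of `Δ₂(ʷt)` (in the hypothesis, not under the goal's binders)
  have key := vanDijkWeight₂_eq_sqrt_prod_normAbs_sub L v (⟨w₀ * (t : ↥(unitaryGroupOfForm (conjLocal L (IsCMField.complexConj L) v) (cmLocalForm L 2 v))) * w₀⁻¹,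
        UnitaryGroup.weylConj_mem_cmTorus_two L v w₀ hw₀ t⟩ : ↥(cmBorelTriple L 2 v).M)
  have h0 : (Fin.rev 0 : Fin 2) = 1 := rfl
  have h1 : (Fin.rev 1 : Fin 2) = 0 := rfl
  rw [torusEntry_weylConj L v w₀ hw₀ t 0, torusEntry_weylConj L v w₀ hw₀ t 1, h0, h1] at key
  rw [key, vanDijkWeight₂_eq_sqrt_prod_normAbs_sub L v t]
  congr 3
  exact Finset.prod_congr rfl fun w _ => by rw [← normAbs_neg, ← Pi.neg_apply, neg_sub]

include hw₀ in
/-- **THE CHART REFLECTION: `ι₂(σ(α)⁻¹) = ʷ(ι₂ α)`** — print's Weyl reflection `w₀` acts on the parameter torus `E_vˣ` by `α ↦ σ(α)⁻¹` (★ `torusChartEntries₂_reflect`,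
★ `glDiagonal_rev_eq_weylConj_two`). [cite: Rogawski1990, §12.2 p. 173; §12.7 L. 12.7.2 (proof) p. 193] -/
theorem torusChart₂_reflect (a : (LocalRing L v)ˣ) :
    torusChart₂ L v (Units.map ((conjLocal L (IsCMField.complexConj L) v : LocalRing L v →+* LocalRing L v) : LocalRing L v →* LocalRing L v) a)⁻¹ =
      ⟨w₀ * ((torusChart₂ L v a : ↥(cmBorelTriple L 2 v).M) : ↥(unitaryGroupOfForm (conjLocal L (IsCMField.complexConj L) v) (cmLocalForm L 2 v))) * w₀⁻¹,
        UnitaryGroup.weylConj_mem_cmTorus_two L v w₀ hw₀ (torusChart₂ L v a)⟩ := by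
  apply Subtype.ext; apply Subtype.ext
  rw [coe_torusChart₂]
  have hrev : torusChartEntries₂ L v (Units.map ((conjLocal L (IsCMField.complexConj L) v : LocalRing L v →+* LocalRing L v) :
      LocalRing L v →* LocalRing L v) a)⁻¹ = fun i => torusChartEntries₂ L v a i.rev := funext fun i => torusChartEntries₂_reflect L v a i
  rw [hrev]
  exact UnitaryGroup.glDiagonal_rev_eq_weylConj_two (conjLocal L (IsCMField.complexConj L) v) (cmLocalForm_eq_over L 2 v) w₀ hw₀ (torusChart₂ L v a)
    (coe_torusChart₂ L v a)

include hw₀ in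
/-- `ʷ(ʷt) = t` on `T₂` (`w₀² ∈ T₂` is central in the abelian torus; here simply: reversing twice). [cite: Rogawski1990, §1.10 p. 9] -/
theorem weylConj_weylConj_eq (t : ↥(cmBorelTriple L 2 v).M) :
    (⟨w₀ * ((⟨w₀ * (t : ↥(unitaryGroupOfForm (conjLocal L (IsCMField.complexConj L) v) (cmLocalForm L 2 v))) * w₀⁻¹,
        UnitaryGroup.weylConj_mem_cmTorus_two L v w₀ hw₀ t⟩ : ↥(cmBorelTriple L 2 v).M) : ↥(unitaryGroupOfForm (conjLocal L (IsCMField.complexConj L) v) (cmLocalForm L 2 v))) * w₀⁻¹,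
        UnitaryGroup.weylConj_mem_cmTorus_two L v w₀ hw₀ _⟩ : ↥(cmBorelTriple L 2 v).M) = t := by
  apply Subtype.ext; apply Subtype.ext
  have hd := glDiagonal_torusEntry_two L v t
  have h1 := UnitaryGroup.glDiagonal_rev_eq_weylConj_two (conjLocal L (IsCMField.complexConj L) v) (cmLocalForm_eq_over L 2 v) w₀ hw₀ t hd
  have h2 := UnitaryGroup.glDiagonal_rev_eq_weylConj_two (conjLocal L (IsCMField.complexConj L) v) (cmLocalForm_eq_over L 2 v) w₀ hw₀ _ h1
  simp only [Fin.rev_rev] at h2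
  rw [← h2, ← hd]

end Weyl

end Summit.HodgeConjecture.HodgeConjecture.Cruxes.H413.K2E3QuasiSplitTwoVanDijkCore

end
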